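import Mathlib
import Summits.QuantumFields.YangMills.Theses.TwistEaterVolume

/-!
# Assembly item of route `TwistEaterVolume` (⟨stmt-QuantumFields-24322⟩)

`Assembly : TubeVolumeLaw → QuadraticGrowth → TauberUniform → VirialFluxGap.SharpTwistedLaplace` is
literally the route's kernel-checked deciding theorem `Theses.TwistEaterVolume.closes` (planner
ym-idea-4 g15: localise by `QuadraticGrowth`, sandwich by `TauberUniform` on the window of the landed
`stub_windowArithmetic`, add the bulk term by the landed `RingDeficit.deficitForm`).

HONEST LABEL: pure glue of a DRAFT-by-design sub-route; the hearts `TubeVolumeLaw` / `QuadraticGrowth`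
stay open; no crux, rung or summit is proved; the Yang–Mills mass gap is NOT proved by this.
-/

namespace Summit.QuantumFields.YangMills.Theorems.TwistEaterVolume

/-- ★ Assembly item ⟨stmt-QuantumFields-24322⟩ BY NAME: the three route items give the leaf
`VirialFluxGap.SharpTwistedLaplace`, by the route's deciding theorem `closes`. -/
theorem assembly_proof : Summit.QuantumFields.YangMills.Theses.TwistEaterVolume.Assembly :=
  fun hV hG hT => Summit.QuantumFields.YangMills.Theses.TwistEaterVolume.closes hV hG hT

end Summit.QuantumFields.YangMills.Theorems.TwistEaterVolume
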